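import Mathlib
import HarnessLib
import Literature.Analysis.FluidPDE.SelfSimilar
import Literature.Analysis.FluidPDE.ClassicalSolution
import Literature.Analysis.FluidPDE.CurlFreeLiouville
import Literature.Analysis.FluidPDE.NSBoundedMildOseenClassical

/-!
# Route UnthreadedDoor · crux `PoloidalLiouville` (stmt-NavierStokesRegularity-1222, shared with
# route ThreadingFlux) · LINE «antidynamo» v2 — stub `stub_constantOfIrrotational` (stub 3)

Seat ns-qj-p1 g3 (director-ns KEY-NS #137 / dss_83), `--supports stmt-NavierStokesRegularity-1222 --as helper`.
Registered skeleton of record: planner ns-idea-6 g5, `PoloidalLiouville_antidynamo_birth_v2.lean`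
(sha16 `4ebf5683127baf3c`); this file proves its stub `StubConstantOfIrrotational` VERBATIM (binders
restated — a Theorems file cannot import the planner's HOME skeleton):

  an IRROTATIONAL slice of a bounded ancient mild solution (`ν = 1`, the tree's duality class) whose
  velocity is jointly `C^∞` on `(−∞,0) × ℝ³` is spatially constant: if `curl v(t) ≡ 0` for all `t < 0`,
  then `v(t, ·) ≡ b(t)`.

PROOF. The slices are weakly divergence free (definition of the class) and `C¹`, hence divergence free
(du Bois-Reymond, tree `IsWeaklyDivFree.isDivFree_of_contDiff`); a bounded `C²` field with
`curl V = 0`, `div V = 0` is harmonic coordinatewise and therefore constant by Liouville (KNSS 2009,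
Lemma 3.1 and the last sentence of the proof of Thm. 5.2; tree
`eq_of_curl_eq_zero_of_isDivFree_of_bounded`).

HONEST FRAMING: the easy closing step of the line (its wall `stub_scalarLiouville` is OPEN); a statement
about HYPOTHETICAL bounded ancient (blow-up profile) solutions; nothing here bears on `PoloidalLiouville`,
on the UnthreadedDoor Target, or on Navier–Stokes regularity; no summit statement is proved here.
[folklore]

References: G. Koch, N. Nadirashvili, G. Seregin, V. Šverák, Acta Math. 203 (2009), Lemma 3.1
(arXiv:0709.3599 p. 7) and proof of Thm. 5.2 (p. 10); L. C. Evans, *PDE*, §5.2.1.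
-/

noncomputable section

-- the summit and its single sub-problem share the name (CONVENTIONS §1), as in every Theorems file
set_option linter.dupNamespace false

namespace Summit.NavierStokesRegularity.NavierStokesRegularity.Theorems.PoloidalLiouville

open MeasureTheory Set Function Filter
open scoped ContDiff
open Literature.Analysis.FluidPDE

/-- **Stub `stub_constantOfIrrotational` (stub 3) of the registered v2 skeleton of crux `PoloidalLiouville`
(stmt-NavierStokesRegularity-1222; LINE «antidynamo», planner ns-idea-6 g5, sha16 `4ebf5683127baf3c`),
signature VERBATIM (`StubConstantOfIrrotational`).** Irrotational slices of a jointly smooth bounded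
ancient mild solution are constant: weakly divergence free + `C¹` ⇒ divergence free; bounded, curl- and
divergence-free `C²` fields on `ℝ³` are constant (harmonic coordinates, Liouville).
[cite: KochNadirashviliSereginSverak2009, Lemma 3.1 (arXiv p. 7) and proof of Thm 5.2, last sentence (p. 10)] -/
theorem constantOfIrrotational :
    ∀ (v : ℝ → EuclideanSpace ℝ (Fin 3) → EuclideanSpace ℝ (Fin 3)),
    Literature.Analysis.FluidPDE.IsBoundedAncientMildSolution 1 v →
    ContDiffOn ℝ (⊤ : ℕ∞) (Function.uncurry v) (Set.Iio 0 ×ˢ Set.univ) →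
    (∀ t < 0, ∀ x, Literature.Analysis.FluidPDE.curl (v t) x = 0) →
    ∀ t < 0, ∃ b : EuclideanSpace ℝ (Fin 3), ∀ x, v t x = b := by
  intro v hB hsm hcurl t ht
  have hsm' : IsSmoothSpaceTimeOn (Iio 0) v := hsm
  have hvt : ContDiff ℝ ∞ (v t) := hsm'.contDiff_slice ht
  have hv2 : ContDiff ℝ 2 (v t) := hvt.of_le (by norm_cast)
  have hv1 : ContDiff ℝ 1 (v t) := hvt.of_le (by norm_cast)
  have hdiv : VectorCalculus.IsDivFree (v t) :=
    (hB.isAncientMildSolution.1 t ht).isDivFree_of_contDiff hv1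
  obtain ⟨M, hM⟩ := hB.isBoundedOn
  exact ⟨v t 0, fun x =>
    eq_of_curl_eq_zero_of_isDivFree_of_bounded hv2 (hcurl t ht) hdiv (fun y => hM t ht y) x 0⟩

/-- Alias under the skeleton's stub name. [folklore] -/
theorem stub_constantOfIrrotational :
    ∀ (v : ℝ → EuclideanSpace ℝ (Fin 3) → EuclideanSpace ℝ (Fin 3)),
    Literature.Analysis.FluidPDE.IsBoundedAncientMildSolution 1 v →
    ContDiffOn ℝ (⊤ : ℕ∞) (Function.uncurry v) (Set.Iio 0 ×ˢ Set.univ) →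
    (∀ t < 0, ∀ x, Literature.Analysis.FluidPDE.curl (v t) x = 0) →
    ∀ t < 0, ∃ b : EuclideanSpace ℝ (Fin 3), ∀ x, v t x = b :=
  constantOfIrrotational

end Summit.NavierStokesRegularity.NavierStokesRegularity.Theorems.PoloidalLiouville

end
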